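import Summits.HodgeConjecture.HodgeCM.Model.WeilCentralCoinvariants_2
import Summits.HodgeConjecture.CorCM.D2Bridge.TwistedCoinvSemilinear
import Literature.NumberTheory.Weil1964.AdelicMetaplecticFinRepConj
import HarnessLib

/-!
# Complex conjugation of the Weil coinvariant module `Ω(s, χ)` (Track T, (T4c) concrete half) — HC_CM is NOT proved

`HodgeCM.WeilCoinv.weilCoinv χ hs` (`HodgeCM/Model/WeilCentralCoinvariants_2.lean` §2) is the `χ`-coinvariant
quotient `Ω(s, χ)` of the finite Weil representation `finPairRep hs = ω_f ∘ s_pair` of the finite-adelic unitary dual pair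
`U(J_V)(𝔸_f) × U(J_W)(𝔸_f)` on `𝒮((𝔸_F^∞)^{N M})`, as a representation of `U(J_V)(𝔸_f)`; at the cell's data it is the
block's Weil module `(line i).Ω ιV χ` (after `.comp ιV`, `asModule`).  This file is the (T4c) step of the re-key plan's
Track T (own-crow PROPOSAL T; ω-side spec of mc-theta-3 2026-08-23T22:19:25Z): the COMPLEX CONJUGATE of `Ω(s, χ)`.

* §1 `conjChar χ = χ̄` (`u ↦ conj (χ u)`); the conjugate finite Weil representation `finPairRepConj hs := (finPairRep hs)ᶜ`
  (`h ↦ C_f ω_f(s_pair h) C_f`, ✔ `Representation.finSBConj`), its two members, and — by the Literature leaf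
  ✔ `Weil1964.AdelicMetaplecticFinRepConj` ((T4b)) — its IDENTIFICATION with the finite Weil factor of the NEGATED Gram
  form `−(T_V ⊗ T_W)` along the conjugate splitting `(pairSmall₁ s ∘ finPairToAdelic)ᶜ` (`finPairRepConj_eq_finRepMp_neg`).
* §2 the conjugate coinvariant representation `weilCoinvConj χ hs := Ω((s_pair)ᶜ, χ̄)` of `U(J_V)(𝔸_f)` and the
  CONJUGATE-LINEAR `U(J_V)(𝔸_f)`-ISOMORPHISM **`weilCoinvConjEquiv : Ω(s, χ) ≃ₛₗ[conj] Ω((s_pair)ᶜ, χ̄)`** induced by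
  `C_f` (✔ `TwistedCoinv.mapEquivₛₗ`), with `weilCoinvConjEquiv (weilCoinv k x) = weilCoinvConj k (weilCoinvConjEquiv x)`.
* §3 consequence for equivariant maps: an `ℂ`-linear `U(J_V)(𝔸_f)`-map `φ : Ω(s, χ) → H` and a conjugate-linear
  `U(J_V)(𝔸_f)`-map `A : H → H'` compose with `weilCoinvConjEquiv⁻¹` to a `ℂ`-LINEAR `U(J_V)(𝔸_f)`-map `Ω((s_pair)ᶜ, χ̄) → H'`
  (`liftConj`, `liftConj_weilCoinvConj`) — the shape «`F∞ ∘ φ ∘ Ω_conj⁻¹` is ℂ-linear and G-equivariant» of (T4).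

NOT here (the remaining (T4b″)∕(T4d) items): the recognition of `(finPairRep hs)ᶜ` as `finPairRep hs̄` of an honest
mirror-line datum `(T_W ↦ −T_W, J_W ↦ −J_W, s ↦ s̄)` through the identifications `U(±J_W)`, `Mp(−(T_V ⊗ T_W)) = Mp(T_V ⊗ (−T_W))`
and the transport of `IsCompatible`; the reading of `χ̄`'s index character (`μ ↦ μᶜ`) and CM type.  HELD; HC_CM is NOT proved.

References: Y. Liu, *Camb. J. Math.* 9 (2021), App. D Lemma D.1 (2) and proof of Lemma D.1 Step 3; J.-S. Li, J. reine
angew. Math. 428 (1992), p. 181 (`ω*` = `ω_{ψ̄}`).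
-/

set_option autoImplicit false

noncomputable section

open scoped TensorProduct ComplexConjugate Kronecker

namespace HodgeCM.WeilCoinv

open Literature.NumberTheory.GelbartRogawski1991 Literature.NumberTheory.GelbartRogawski1991.UnitaryDualPair
open Literature.NumberTheory.Automorphic Literature.NumberTheory.Weil1964
open NumberField

variable (F E : Type) [Field F] [NumberField F] [Field E] [NumberField E] [Algebra F E]
variable (c : E ≃ₐ[F] E) (N M : ℕ) {n : ℕ} (e : Fin N × Fin M ≃ Fin n)
variable (JV : Matrix (Fin N) (Fin N) E) (JW : Matrix (Fin M) (Fin M) E)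
variable {TV : Matrix (Fin N) (Fin N) F} {TW : Matrix (Fin M) (Fin M) F}
variable [Algebra.IsQuadraticExtension F E] {δ : E} (hcδ : c δ = -δ) (hδ : δ ≠ 0) {d : F}
  (hd : δ * δ = algebraMap F E d) (hV : TV.IsSymm) (hW : TW.IsSymm) (hVd : IsUnit TV.det) (hWd : IsUnit TW.det)
  (hJV : JV = TV.map (algebraMap F E)) (hJW : JW = TW.map (algebraMap F E))
  {s : UnitaryGroup.adelicPair F E c N M JV JW →* adelicMpCont F (Fin n) (adelicGram F e TV TW)}

/-! ## §1 The conjugate character and the conjugate finite Weil representation -/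

/-- **`χ̄ = conj ∘ χ`**, the complex-conjugate character of `U(J_W)(𝔸_f)` (for a unitary `χ` this is `χ⁻¹`).
[cite: Liu2021, App. D Lemma D.1 (2)] -/
def conjChar (χ : UnitaryGroup.finAdelic F E c M JW →* ℂˣ) : UnitaryGroup.finAdelic F E c M JW →* ℂˣ :=
  (Units.map ((starRingEnd ℂ : ℂ →+* ℂ) : ℂ →* ℂ)).comp χ

omit [NumberField F] [Algebra.IsQuadraticExtension F E] in
/-- value of `χ̄`. [cite: Liu2021, App. D Lemma D.1 (2)] -/
@[simp] theorem coe_conjChar_apply (χ : UnitaryGroup.finAdelic F E c M JW →* ℂˣ) (u : UnitaryGroup.finAdelic F E c M JW) :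
    ((conjChar F E c M JW χ u : ℂˣ) : ℂ) = conj ((χ u : ℂˣ) : ℂ) :=
  rfl

omit [NumberField F] [Algebra.IsQuadraticExtension F E] in
/-- `χ̄̄ = χ`. [cite: Liu2021, App. D Lemma D.1 (2)] -/
@[simp] theorem conjChar_conjChar (χ : UnitaryGroup.finAdelic F E c M JW →* ℂˣ) :
    conjChar F E c M JW (conjChar F E c M JW χ) = χ :=
  MonoidHom.ext fun u => Units.ext (by rw [coe_conjChar_apply, coe_conjChar_apply, Complex.conj_conj])

/-- **the conjugate finite Weil representation `(ω_f ∘ s_pair)ᶜ : h ↦ C_f ω_f(s_pair h) C_f`** of the finite-adelic dual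
pair on `𝒮((𝔸_F^∞)^{N M})`. [cite: Li1992, p. 181; Liu2021, App. D Lemma D.1 (2)] -/
def finPairRepConj (hs : (splittingDatum F E c N M e JV JW hcδ hδ hd hV hW hVd hWd hJV hJW).IsCompatible s) :
    Representation ℂ (UnitaryGroup.finAdelic F E c N JV × UnitaryGroup.finAdelic F E c M JW) (FinSB F (Fin N × Fin M)) :=
  (finPairRep F E c N M e JV JW hcδ hδ hd hV hW hVd hWd hJV hJW hs).finSBConj

/-- **(T4b) at the dual pair: the conjugate finite Weil representation IS the finite Weil factor of the NEGATED Gram form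
`−(T_V ⊗ T_W)` along the conjugate splitting `(pairSmall₁ s ∘ finPairToAdelic)ᶜ`.** [cite: Li1992, p. 181; Weil1964, Chap. III n° 37–38 pp. 188–190] -/
theorem finPairRepConj_eq_finRepMp_neg
    (hs : (splittingDatum F E c N M e JV JW hcδ hδ hd hV hW hVd hWd hJV hJW).IsCompatible s) :
    finPairRepConj F E c N M e JV JW hcδ hδ hd hV hW hVd hWd hJV hJW hs =
      finRepMp (isUnit_kronecker_map F N hVd hWd).neg
        (splittingConj ((pairSmall₁ F E c N M e JV JW s).comp (finPairToAdelic F E c N M JV JW)))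
        (archVec_fixed_splittingConj _ fun p a w =>
          proj_pairSmall₁_finAdelic_apply_archVec F E c N M e JV JW hcδ hδ hd hV hW hVd hWd hJV hJW hs p.1 p.2 a w) :=
  (finRepMp_splittingConj_eq (isUnit_kronecker_map F N hVd hWd)
    ((pairSmall₁ F E c N M e JV JW s).comp (finPairToAdelic F E c N M JV JW))
    (fun p a w => proj_pairSmall₁_finAdelic_apply_archVec F E c N M e JV JW hcδ hδ hd hV hW hVd hWd hJV hJW hs
      p.1 p.2 a w)).symm

/-- pointwise: `(ω_f ∘ s_pair)ᶜ h Φ = C_f (ω_f(s_pair h) (C_f Φ))`. [cite: Li1992, p. 181] -/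
@[simp] theorem finPairRepConj_apply
    (hs : (splittingDatum F E c N M e JV JW hcδ hδ hd hV hW hVd hWd hJV hJW).IsCompatible s)
    (h : UnitaryGroup.finAdelic F E c N JV × UnitaryGroup.finAdelic F E c M JW) (Φ : FinSB F (Fin N × Fin M)) :
    finPairRepConj F E c N M e JV JW hcδ hδ hd hV hW hVd hWd hJV hJW hs h Φ =
      finSBConj (finPairRep F E c N M e JV JW hcδ hδ hd hV hW hVd hWd hJV hJW hs h (finSBConj Φ)) :=
  rfl

/-- its `U(J_V)`-member. [cite: Li1992, p. 181] -/
def finPairRepConjV (hs : (splittingDatum F E c N M e JV JW hcδ hδ hd hV hW hVd hWd hJV hJW).IsCompatible s) :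
    Representation ℂ (UnitaryGroup.finAdelic F E c N JV) (FinSB F (Fin N × Fin M)) :=
  (finPairRepConj F E c N M e JV JW hcδ hδ hd hV hW hVd hWd hJV hJW hs).comp (MonoidHom.inl _ _)

/-- its `U(J_W)`-member. [cite: Li1992, p. 181] -/
def finPairRepConjW (hs : (splittingDatum F E c N M e JV JW hcδ hδ hd hV hW hVd hWd hJV hJW).IsCompatible s) :
    Representation ℂ (UnitaryGroup.finAdelic F E c M JW) (FinSB F (Fin N × Fin M)) :=
  (finPairRepConj F E c N M e JV JW hcδ hδ hd hV hW hVd hWd hJV hJW hs).comp (MonoidHom.inr _ _)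

/-- `(ω_f ∘ s_pair)ᶜ_V k = C_f (ω_f ∘ s_pair)_V k C_f`. [cite: Li1992, p. 181] -/
theorem finPairRepConjV_apply (hs : (splittingDatum F E c N M e JV JW hcδ hδ hd hV hW hVd hWd hJV hJW).IsCompatible s)
    (k : UnitaryGroup.finAdelic F E c N JV) (Φ : FinSB F (Fin N × Fin M)) :
    finPairRepConjV F E c N M e JV JW hcδ hδ hd hV hW hVd hWd hJV hJW hs k Φ =
      finSBConj (finPairRepV F E c N M e JV JW hcδ hδ hd hV hW hVd hWd hJV hJW hs k (finSBConj Φ)) :=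
  rfl

/-- `(ω_f ∘ s_pair)ᶜ_W u = C_f (ω_f ∘ s_pair)_W u C_f`. [cite: Li1992, p. 181] -/
theorem finPairRepConjW_apply (hs : (splittingDatum F E c N M e JV JW hcδ hδ hd hV hW hVd hWd hJV hJW).IsCompatible s)
    (u : UnitaryGroup.finAdelic F E c M JW) (Φ : FinSB F (Fin N × Fin M)) :
    finPairRepConjW F E c N M e JV JW hcδ hδ hd hV hW hVd hWd hJV hJW hs u Φ =
      finSBConj (finPairRepW F E c N M e JV JW hcδ hδ hd hV hW hVd hWd hJV hJW hs u (finSBConj Φ)) :=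
  rfl

/-- the two conjugate members commute. [cite: Li1992, p. 181] -/
theorem commute_finPairRepConjV_finPairRepConjW
    (hs : (splittingDatum F E c N M e JV JW hcδ hδ hd hV hW hVd hWd hJV hJW).IsCompatible s)
    (k : UnitaryGroup.finAdelic F E c N JV) (u : UnitaryGroup.finAdelic F E c M JW) :
    Commute (finPairRepConjV F E c N M e JV JW hcδ hδ hd hV hW hVd hWd hJV hJW hs k)
      (finPairRepConjW F E c N M e JV JW hcδ hδ hd hV hW hVd hWd hJV hJW hs u) := by
  refine LinearMap.ext fun Φ => ?_
  rw [Module.End.mul_apply, Module.End.mul_apply, finPairRepConjV_apply, finPairRepConjW_apply,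
    finPairRepConjV_apply, finPairRepConjW_apply, finSBConj_finSBConj, finSBConj_finSBConj]
  have h := LinearMap.congr_fun
    (commute_finPairRepV_finPairRepW F E c N M e JV JW hcδ hδ hd hV hW hVd hWd hJV hJW hs k u).eq (finSBConj Φ)
  simp only [Module.End.mul_apply] at h
  rw [h]

/-- `C_f` intertwines the `W`-members: `C_f ((ω_f ∘ s_pair)_W u Φ) = (ω_f ∘ s_pair)ᶜ_W u (C_f Φ)`. [cite: Li1992, p. 181] -/
theorem finSBConj_finPairRepW (hs : (splittingDatum F E c N M e JV JW hcδ hδ hd hV hW hVd hWd hJV hJW).IsCompatible s)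
    (u : UnitaryGroup.finAdelic F E c M JW) (Φ : FinSB F (Fin N × Fin M)) :
    finSBConjₛₗ (finPairRepW F E c N M e JV JW hcδ hδ hd hV hW hVd hWd hJV hJW hs u Φ) =
      finPairRepConjW F E c N M e JV JW hcδ hδ hd hV hW hVd hWd hJV hJW hs u (finSBConjₛₗ Φ) := by
  rw [finSBConjₛₗ_apply, finSBConjₛₗ_apply, finPairRepConjW_apply, finSBConj_finSBConj]

/-- `C_f` intertwines the `V`-members. [cite: Li1992, p. 181] -/
theorem finSBConj_finPairRepV (hs : (splittingDatum F E c N M e JV JW hcδ hδ hd hV hW hVd hWd hJV hJW).IsCompatible s)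
    (k : UnitaryGroup.finAdelic F E c N JV) (Φ : FinSB F (Fin N × Fin M)) :
    finSBConjₛₗ (finPairRepV F E c N M e JV JW hcδ hδ hd hV hW hVd hWd hJV hJW hs k Φ) =
      finPairRepConjV F E c N M e JV JW hcδ hδ hd hV hW hVd hWd hJV hJW hs k (finSBConjₛₗ Φ) := by
  rw [finSBConjₛₗ_apply, finSBConjₛₗ_apply, finPairRepConjV_apply, finSBConj_finSBConj]

/-! ## §2 The conjugate coinvariant module and the conjugate-linear isomorphism -/

variable (χ : UnitaryGroup.finAdelic F E c M JW →* ℂˣ)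

/-- **`Ω((s_pair)ᶜ, χ̄)`**: the `χ̄`-coinvariants of the conjugate finite Weil representation under `U(J_W)(𝔸_f)`, as a
representation of `U(J_V)(𝔸_f)`. [cite: Liu2021, App. D Lemma D.1 (2); Liu2021, App. D proof of Lemma D.1 Step 3] -/
def weilCoinvConj (hs : (splittingDatum F E c N M e JV JW hcδ hδ hd hV hW hVd hWd hJV hJW).IsCompatible s) :
    Representation ℂ (UnitaryGroup.finAdelic F E c N JV)
      (TwistedCoinv.Coinv (finPairRepConjW F E c N M e JV JW hcδ hδ hd hV hW hVd hWd hJV hJW hs)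
        (conjChar F E c M JW χ)) :=
  TwistedCoinv.rep (conjChar F E c M JW χ) (finPairRepConjV F E c N M e JV JW hcδ hδ hd hV hW hVd hWd hJV hJW hs)
    (commute_finPairRepConjV_finPairRepConjW F E c N M e JV JW hcδ hδ hd hV hW hVd hWd hJV hJW hs)

/-- on generators: `weilCoinvConj k (mk Φ) = mk ((ω_f ∘ s_pair)ᶜ_V k Φ)`. [cite: Liu2021, App. D proof of Lemma D.1 Step 3] -/
@[simp] theorem weilCoinvConj_mk (hs : (splittingDatum F E c N M e JV JW hcδ hδ hd hV hW hVd hWd hJV hJW).IsCompatible s)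
    (k : UnitaryGroup.finAdelic F E c N JV) (Φ : FinSB F (Fin N × Fin M)) :
    weilCoinvConj F E c N M e JV JW hcδ hδ hd hV hW hVd hWd hJV hJW χ hs k
        (TwistedCoinv.mk (finPairRepConjW F E c N M e JV JW hcδ hδ hd hV hW hVd hWd hJV hJW hs) (conjChar F E c M JW χ) Φ) =
      TwistedCoinv.mk (finPairRepConjW F E c N M e JV JW hcδ hδ hd hV hW hVd hWd hJV hJW hs) (conjChar F E c M JW χ)
        (finPairRepConjV F E c N M e JV JW hcδ hδ hd hV hW hVd hWd hJV hJW hs k Φ) :=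
  rfl

/-- **`Ω_conj : Ω(s, χ) ≃ₛₗ[conj] Ω((s_pair)ᶜ, χ̄)`** — the conjugate-linear bijection induced by `C_f : Φ_f ↦ Φ̄_f` on the
coinvariant quotients (`C_f` carries the relations `ω_f(1,u)Φ − χ(u)Φ` to `(ω_f)ᶜ(1,u)Φ̄ − χ̄(u)Φ̄`).
[cite: Liu2021, App. D Lemma D.1 (2); Li1992, p. 181] -/
def weilCoinvConjEquiv (hs : (splittingDatum F E c N M e JV JW hcδ hδ hd hV hW hVd hWd hJV hJW).IsCompatible s) :
    TwistedCoinv.Coinv (finPairRepW F E c N M e JV JW hcδ hδ hd hV hW hVd hWd hJV hJW hs) χ ≃ₛₗ[starRingEnd ℂ]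
      TwistedCoinv.Coinv (finPairRepConjW F E c N M e JV JW hcδ hδ hd hV hW hVd hWd hJV hJW hs) (conjChar F E c M JW χ) :=
  TwistedCoinv.mapEquivₛₗ (finPairRepW F E c N M e JV JW hcδ hδ hd hV hW hVd hWd hJV hJW hs) χ
    (finPairRepConjW F E c N M e JV JW hcδ hδ hd hV hW hVd hWd hJV hJW hs) (conjChar F E c M JW χ)
    finSBConjₛₗ (Equiv.refl _) (finSBConj_finPairRepW F E c N M e JV JW hcδ hδ hd hV hW hVd hWd hJV hJW hs)
    (fun u => coe_conjChar_apply F E c M JW χ u)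

/-- on generators: `Ω_conj (mk Φ) = mk (C_f Φ)`. [cite: Liu2021, App. D proof of Lemma D.1 Step 3] -/
@[simp] theorem weilCoinvConjEquiv_mk
    (hs : (splittingDatum F E c N M e JV JW hcδ hδ hd hV hW hVd hWd hJV hJW).IsCompatible s) (Φ : FinSB F (Fin N × Fin M)) :
    weilCoinvConjEquiv F E c N M e JV JW hcδ hδ hd hV hW hVd hWd hJV hJW χ hs
        (TwistedCoinv.mk (finPairRepW F E c N M e JV JW hcδ hδ hd hV hW hVd hWd hJV hJW hs) χ Φ) =
      TwistedCoinv.mk (finPairRepConjW F E c N M e JV JW hcδ hδ hd hV hW hVd hWd hJV hJW hs) (conjChar F E c M JW χ)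
        (finSBConj Φ) :=
  rfl

/-- on generators, inverse: `Ω_conj⁻¹ (mk Φ) = mk (C_f Φ)`. [cite: Liu2021, App. D proof of Lemma D.1 Step 3] -/
@[simp] theorem weilCoinvConjEquiv_symm_mk
    (hs : (splittingDatum F E c N M e JV JW hcδ hδ hd hV hW hVd hWd hJV hJW).IsCompatible s) (Φ : FinSB F (Fin N × Fin M)) :
    (weilCoinvConjEquiv F E c N M e JV JW hcδ hδ hd hV hW hVd hWd hJV hJW χ hs).symm
        (TwistedCoinv.mk (finPairRepConjW F E c N M e JV JW hcδ hδ hd hV hW hVd hWd hJV hJW hs) (conjChar F E c M JW χ) Φ) =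
      TwistedCoinv.mk (finPairRepW F E c N M e JV JW hcδ hδ hd hV hW hVd hWd hJV hJW hs) χ (finSBConj Φ) :=
  rfl

/-- **`Ω_conj` is `U(J_V)(𝔸_f)`-equivariant**: `Ω_conj (Ω(s,χ)(k) x) = Ω((s_pair)ᶜ, χ̄)(k) (Ω_conj x)`.
[cite: Liu2021, App. D Lemma D.1 (2); Li1992, p. 181] -/
theorem weilCoinvConjEquiv_weilCoinv
    (hs : (splittingDatum F E c N M e JV JW hcδ hδ hd hV hW hVd hWd hJV hJW).IsCompatible s)
    (k : UnitaryGroup.finAdelic F E c N JV)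
    (x : TwistedCoinv.Coinv (finPairRepW F E c N M e JV JW hcδ hδ hd hV hW hVd hWd hJV hJW hs) χ) :
    weilCoinvConjEquiv F E c N M e JV JW hcδ hδ hd hV hW hVd hWd hJV hJW χ hs
        (weilCoinv F E c N M e JV JW hcδ hδ hd hV hW hVd hWd hJV hJW χ hs k x) =
      weilCoinvConj F E c N M e JV JW hcδ hδ hd hV hW hVd hWd hJV hJW χ hs k
        (weilCoinvConjEquiv F E c N M e JV JW hcδ hδ hd hV hW hVd hWd hJV hJW χ hs x) :=
  TwistedCoinv.mapEquivₛₗ_rep _ χ _ (conjChar F E c M JW χ) _ _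
    (commute_finPairRepV_finPairRepW F E c N M e JV JW hcδ hδ hd hV hW hVd hWd hJV hJW hs)
    (commute_finPairRepConjV_finPairRepConjW F E c N M e JV JW hcδ hδ hd hV hW hVd hWd hJV hJW hs)
    finSBConjₛₗ (Equiv.refl _) (finSBConj_finPairRepW F E c N M e JV JW hcδ hδ hd hV hW hVd hWd hJV hJW hs)
    (fun u => coe_conjChar_apply F E c M JW χ u)
    (finSBConj_finPairRepV F E c N M e JV JW hcδ hδ hd hV hW hVd hWd hJV hJW hs) k x

/-! ## §3 Composition with a conjugate-linear equivariant map downstream -/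

section LiftConj

variable {G : Type*} [Group G] (ιV : G →* UnitaryGroup.finAdelic F E c N JV)
variable {H H' : Type*} [AddCommGroup H] [Module ℂ H] [AddCommGroup H'] [Module ℂ H']

/-- **`A ∘ φ ∘ Ω_conj⁻¹`**: for a `ℂ`-linear `φ : Ω(s, χ) → H` and a conjugate-linear `A : H → H'`, the composite out of the
conjugate module `Ω((s_pair)ᶜ, χ̄)` is `ℂ`-LINEAR (two conjugate-linear maps compose to a linear one).
[cite: Liu2021, App. D Lemma D.1 (2)] -/
def liftConj (hs : (splittingDatum F E c N M e JV JW hcδ hδ hd hV hW hVd hWd hJV hJW).IsCompatible s)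
    (φ : TwistedCoinv.Coinv (finPairRepW F E c N M e JV JW hcδ hδ hd hV hW hVd hWd hJV hJW hs) χ →ₗ[ℂ] H)
    (A : H →ₛₗ[starRingEnd ℂ] H') :
    TwistedCoinv.Coinv (finPairRepConjW F E c N M e JV JW hcδ hδ hd hV hW hVd hWd hJV hJW hs) (conjChar F E c M JW χ)
      →ₗ[ℂ] H' :=
  (A.comp φ).comp
    ((weilCoinvConjEquiv F E c N M e JV JW hcδ hδ hd hV hW hVd hWd hJV hJW χ hs).symm :
      TwistedCoinv.Coinv (finPairRepConjW F E c N M e JV JW hcδ hδ hd hV hW hVd hWd hJV hJW hs) (conjChar F E c M JW χ)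
        →ₛₗ[starRingEnd ℂ] TwistedCoinv.Coinv (finPairRepW F E c N M e JV JW hcδ hδ hd hV hW hVd hWd hJV hJW hs) χ)

/-- formula: `liftConj φ A y = A (φ (Ω_conj⁻¹ y))`. [cite: Liu2021, App. D Lemma D.1 (2)] -/
@[simp] theorem liftConj_apply (hs : (splittingDatum F E c N M e JV JW hcδ hδ hd hV hW hVd hWd hJV hJW).IsCompatible s)
    (φ : TwistedCoinv.Coinv (finPairRepW F E c N M e JV JW hcδ hδ hd hV hW hVd hWd hJV hJW hs) χ →ₗ[ℂ] H)
    (A : H →ₛₗ[starRingEnd ℂ] H')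
    (y : TwistedCoinv.Coinv (finPairRepConjW F E c N M e JV JW hcδ hδ hd hV hW hVd hWd hJV hJW hs) (conjChar F E c M JW χ)) :
    liftConj F E c N M e JV JW hcδ hδ hd hV hW hVd hWd hJV hJW χ hs φ A y =
      A (φ ((weilCoinvConjEquiv F E c N M e JV JW hcδ hδ hd hV hW hVd hWd hJV hJW χ hs).symm y)) :=
  rfl

/-- **equivariance of `A ∘ φ ∘ Ω_conj⁻¹`** along `ιV : G → U(J_V)(𝔸_f)`: if `φ` intertwines `Ω(s,χ) ∘ ιV` with a `G`-action
`σ` on `H` and `A` intertwines `σ` with `σ'` on `H'`, then `liftConj φ A` intertwines `Ω((s_pair)ᶜ, χ̄) ∘ ιV` with `σ'`.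
[cite: Liu2021, App. D Lemma D.1 (2)] -/
theorem liftConj_weilCoinvConj
    (hs : (splittingDatum F E c N M e JV JW hcδ hδ hd hV hW hVd hWd hJV hJW).IsCompatible s)
    (φ : TwistedCoinv.Coinv (finPairRepW F E c N M e JV JW hcδ hδ hd hV hW hVd hWd hJV hJW hs) χ →ₗ[ℂ] H)
    (A : H →ₛₗ[starRingEnd ℂ] H') (σ : G → H →ₗ[ℂ] H) (σ' : G → H' →ₗ[ℂ] H')
    (hφ : ∀ (g : G) (x : TwistedCoinv.Coinv (finPairRepW F E c N M e JV JW hcδ hδ hd hV hW hVd hWd hJV hJW hs) χ),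
      φ (weilCoinv F E c N M e JV JW hcδ hδ hd hV hW hVd hWd hJV hJW χ hs (ιV g) x) = σ g (φ x))
    (hA : ∀ (g : G) (y : H), A (σ g y) = σ' g (A y)) (g : G)
    (y : TwistedCoinv.Coinv (finPairRepConjW F E c N M e JV JW hcδ hδ hd hV hW hVd hWd hJV hJW hs) (conjChar F E c M JW χ)) :
    liftConj F E c N M e JV JW hcδ hδ hd hV hW hVd hWd hJV hJW χ hs φ A
        (weilCoinvConj F E c N M e JV JW hcδ hδ hd hV hW hVd hWd hJV hJW χ hs (ιV g) y) =
      σ' g (liftConj F E c N M e JV JW hcδ hδ hd hV hW hVd hWd hJV hJW χ hs φ A y) := by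
  set Ω := weilCoinvConjEquiv F E c N M e JV JW hcδ hδ hd hV hW hVd hWd hJV hJW χ hs with hΩ
  obtain ⟨x, rfl⟩ := Ω.surjective y
  have h1 : Ω (weilCoinv F E c N M e JV JW hcδ hδ hd hV hW hVd hWd hJV hJW χ hs (ιV g) x) =
      weilCoinvConj F E c N M e JV JW hcδ hδ hd hV hW hVd hWd hJV hJW χ hs (ιV g) (Ω x) :=
    weilCoinvConjEquiv_weilCoinv F E c N M e JV JW hcδ hδ hd hV hW hVd hWd hJV hJW χ hs (ιV g) x
  rw [← h1, liftConj_apply, liftConj_apply, ← hΩ, LinearEquiv.symm_apply_apply, LinearEquiv.symm_apply_apply, hφ, hA]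

end LiftConj

end HodgeCM.WeilCoinv
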